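import Summits.Langlands.Langlands.Theses.PrimeSwitchSplit
import Summits.Langlands.Langlands.Theorems.IrreducibilityBySelfDualityReciprocityUpToIrreducibilityRTightness
import HarnessLib

/-!
# Crux `PrimeSwitchSplit.CompatibilityAwayFromLR` (stmt-Langlands-18084) — Negative lane: TIGHTNESS of the `∀ Rec` layer
# (`--supports` file; no definitions; refuter crux-attack at birth, 2026-08-17)

The crux L∤R asks local–global compatibility away from `ℓ` for EVERY pinned reciprocity datum `Rec`.  The
datum enters only through the class `(Rec.llc v).recGL n [π_v]` of the local component.  This file records
the necessity half of the equivalence "L∤R ⟺ (L∤ at one datum) ∧ (rigidity of pinned data on avatar-bearing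
local components)": the crux FORCES any two reciprocity data to agree on the local component at `v ∤ ℓ` of
every L-algebraic cuspidal `π` carrying an irreducible pinned-geometric `ℓ`-adic avatar Satake-compatible
a.e.  Hence the planner's kill criterion ("a legal `ReciprocityData` whose `rec_v` is off at a ramified
generic class") can only bite through such a realised pair — and on generic classes two pinned data agree
modulo the printed local facts (`ReciprocityUpToIrreducibilityR.stub_genericRigidity_of_facts`, landed).
Proof: both data are compatible with the SAME pair `(π, ρ)` at `v` (the crux at `Rec` and at `Rec'`; the
pinned-geometric hypothesis is `Rec`-free); two Grothendieck–Deligne Weil–Deligne representations of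
`ρ|_{W_v}` are isomorphic (`IsWeilDeligneOfLadic.isEquivalent_holds`), isomorphic representations have
complex transports with ONE Frobenius-semisimple class, and local components are unique up to isomorphism
(`AutomorphicRepData.hasLocalComponentAt_unique_holds`) — packaged in the landed
`ReciprocityUpToIrreducibilityR.recGL_eq_of_localGlobalCompatibleAtR` (module `…RTightness`), reused here.
Standard axioms only; no `sorry`; no definitions.
-/

noncomputable section


open scoped MatrixGroups NumberField
open IsDedekindDomain Filter
open Literature.NumberTheory.Automorphic Literature.NumberTheory.GaloisRepresentations
open Summit.Langlands Summit.Langlands.Langlands.Theses.PrimeSwitchSplit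
open Summit.Langlands.Langlands.Theorems

namespace Summit.Langlands.Langlands.Theorems.CompatibilityAwayFromLR

/-! ## Tightness of the `∀ Rec` layer -/

/-- **Tightness of the `∀ Rec` layer of `CompatibilityAwayFromLR`.**  If the crux holds, then for any two
pinned reciprocity data `Rec Rec'` of a number field `K`, every L-algebraic cuspidal `π` of `GL_n(𝔸_K)`
(`n ≥ 1`), every prime `ℓ`, `ι : ℚ̄_ℓ ≃ ℂ` and every irreducible pinned-geometric `ℓ`-adic `ρ`
Satake–Frobenius compatible with `(π, ι)` at almost all places, the two data AGREE on the class of every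
local component `π_v` of `π` at every finite `v ∤ ℓ`: both are locally–globally compatible with the one pair
`(π, ρ)` at `v` (the crux at `Rec` and at `Rec'`). [cite: DeligneAntwerpII1973, §8.4.2] -/
theorem recGL_eq_of_compatibilityAwayFromLR (hC : CompatibilityAwayFromLR) (K : Type) [Field K]
    [NumberField K] (Rec Rec' : ReciprocityData K) (n : ℕ) (hcpt : isCompact_glFiniteIntegralLevel n K)
    (hn : 0 < n) (π : CuspidalAutomorphicRepData n K hcpt) (hL : π.1.IsLAlgebraic)
    (ℓ : ℕ) [Fact ℓ.Prime] (ι : PadicAlgCl ℓ ≃+* ℂ) (ρ : FramedGaloisRep K (PadicAlgCl ℓ) n)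
    (hirr : ρ.toGaloisRep.IsIrreducible)
    (hgeo : (∀ᶠ v : HeightOneSpectrum (𝓞 K) in cofinite, ρ.IsUnramifiedAt v) ∧
      ∀ (v : HeightOneSpectrum (𝓞 K)) (hv : ((ℓ : ℕ) : 𝓞 K) ∈ v.asIdeal),
        (Literature.NumberTheory.PAdicHodge.fontainePstAdicCompletion v ℓ hv).IsDeRhamFramed (ρ.toLocal v))
    (hρ : ∀ᶠ v : HeightOneSpectrum (𝓞 K) in cofinite, SatakeFrobCompatibleAt ι π.1 ρ v)
    (v : HeightOneSpectrum (𝓞 K)) (hv : ((ℓ : ℕ) : 𝓞 K) ∉ v.asIdeal)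
    (πv : SmoothIrrep (GL (Fin n) (v.adicCompletion K))) (hπv : π.1.HasLocalComponentAt v πv.ρ) :
    (Rec.llc v).recGL n (IrrClass.mk πv) = (Rec'.llc v).recGL n (IrrClass.mk πv) :=
  ReciprocityUpToIrreducibilityR.recGL_eq_of_localGlobalCompatibleAtR Rec Rec' ι π ρ hv
    (hC K Rec n hcpt hn π hL ℓ ι ρ hirr hgeo hρ v hv) (hC K Rec' n hcpt hn π hL ℓ ι ρ hirr hgeo hρ v hv) πv hπv

end Summit.Langlands.Langlands.Theorems.CompatibilityAwayFromLR

end
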